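import Mathlib
import Summits.Ventures.HodgeRepro2.Tier7.Line3.DoubleCosetCover
import Summits.Ventures.HodgeRepro2.Tier7.Line3.CosetEntryBounds
import Summits.Ventures.HodgeRepro2.Tier7.Line3.CoverCountLink

/-!
# Tier7/Line3/CoverCountCartan — the count-side link at a CARTAN cover of the model `K = GL₂(O)`: `hD`, `hm`, `hn` discharged

Filer: t7-L1-p3 (gen 9, prover-pub-hodge-repro2-t7-L1-p3-g9-0); the companion of CoverCountLink (layer (B) of plan-3's
TWIN RULING STATUS l. 16077 — its section C5, a separate file by the 400-line rule) composing it with CosetEntryBounds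
(p714165) and L1-p2's DoubleCosetCover (p714118). Lane: Line 3 SUPPORT, [M]-level consolidation of the split-place row;
NOT a line, NOT a device; touches neither residual clause (a′) nor (b′) of the line.

WHAT IT SUPPLIES. CoverCountLink bounds the split-place box count over a displayed finite cover `U ⊆ ⋃_{j ∈ T} D j` by
`(∑_{j ∈ T} (1 + |m_j − n_j|)²) · (1 + M₁)(1 + M₂)`, taking as DISPLAYED the per-coset shape `hD j` («entries of value
`≤ u_j`, determinant of value `δ_j`») and the Cartan data `hm j` / `hn j` (`ord u_j = −min (m_j, n_j)`,
`ord δ_j = −(m_j + n_j)`). Here those three are DISCHARGED: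
* E1 `ncard_image_valuePair_sol_le_cartanCover`: for `K` integral (`IsIntegralSubgroup v K`), a uniformiser `ϖ`
  (`v ϖ = ofAdd (−1)`) and a displayed finite cover of `U` by the images of the double cosets `K g_j K` of Cartan
  representatives `(g_j : Matrix) = diag(ϖ^{m_j}, ϖ^{n_j})`, the same bound — `hD` by `cartan_doubleCoset_bounds`,
  `hm` / `hn` by `ord_cartan_u` / `ord_cartan_δ` (CosetEntryBounds);
* E2 `isIntegralSubgroup_integralSubgroup`: the model `K = GL₂(O)` — DoubleCosetCover's `integralSubgroup (v.integer)`,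
  `O = {x | v x ≤ 1}` — is integral; `ncard_image_valuePair_sol_le_cartanCover_model` is E1 at that `K`;
* E3 THE CONSUMER (CoverCountLink's C4, moved here by the 400-line rule): `exists_splitFactor_le_of_covers` =
  SplitFactorConstants' `exists_splitFactor_le_const` with `b w γ := #(value pairs of the solutions of U w at γ)`,
  `Cw w := max 1 (∑_{j ∈ T w} (1 + |m_j − n_j|)²)` and its per-place bound `hb` DISCHARGED at every place by
  CoverCountLink's `ncard_image_valuePair_sol_le_real` — one constant `C` for all `γ` from per-place displayed covers;
  the displayed `he₁ : e₁ ≤ multiplicity w.asIdeal (I γ)`, `he₂ : e₂ ≤ multiplicity w.asIdeal (J γ)` are the (h⁵⁗)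
  dictionary clause «`1 + v_w⁺(κ) ≤ 1 + mult_w (I γ)`» (plan-3 l. 15989 (b) / l. 16137 (3)), the link to NumeratorNorm /
  NumeratorIdealSize; every `γ` is asked to have non-zero entries and determinant at every place (no junk value).
So the split-place per-place bound `b w γ ≤ Cw w (1 + e₁)(1 + e₂)` of SplitFactorConstants is a theorem of: the field
`(F, v, ϖ)`, the entries of `γ`, and ONE displayed object — the finite cover of `U` by Cartan double cosets of `GL₂(O)`.

WHAT STAYS IN WORDS (the dictionary, (a′)): the Cartan decomposition itself (every double coset `K g K` of
`K = GL₂(O)` has a representative `diag(ϖ^m, ϖ^n)` — the elementary-divisor theorem of the DVR; with it and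
DoubleCosetCover's `exists_finset_doubleCoset_cover` the displayed cover would be a theorem of `U` compact); that
`b w γ = #(value pairs)` for the real `U = supp f_w`; `e₁ ≤ ord_w (I γ)`, `e₂ ≤ ord_w (J γ)`; the place datum. Nothing
here is about (N), (P), the real `X`, or HC_CM. §8(d): NO. Blind lane: Mathlib + the HodgeRepro2 prefix; no sorry;
axioms ⊆ {propext, Classical.choice, Quot.sound}.
-/

namespace Summit.Ventures.HodgeRepro2.Tier7.Line3.CoverCountCartan

open Matrix Summit.Ventures.HodgeRepro2.Tier7.Line3.SplitOrbitBox
  Summit.Ventures.HodgeRepro2.Tier7.Line3.CoverCountLink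

/-! ## E1. The composite at a Cartan cover: `hD`, `hm`, `hn` of the count-side link discharged -/

section CartanCover

open WithZero Multiplicative Summit.Ventures.HodgeRepro2.Tier7.Line3.CosetEntryBounds

variable {F : Type*} [Field F]

/-- **THE COUNT-SIDE LINK AT A CARTAN COVER**: for `K` integral (`IsIntegralSubgroup v K`, the model `K = GL₂(O)`), a
uniformiser `ϖ` (`v ϖ = ofAdd (−1)`) and a displayed FINITE COVER of `U` by the images of the double cosets `K g_j K` of
Cartan representatives `(g_j : Matrix) = diag(ϖ^{m_j}, ϖ^{n_j})`, `j ∈ T`: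
`#(value pairs) ≤ (∑_{j ∈ T} (1 + |m_j − n_j|)²) · (1 + M₁)(1 + M₂)` for integers `M₁ ≥ e₁`, `M₂ ≥ e₂`, `M₁, M₂ ≥ 0` —
the per-coset clause `hD` and the Cartan data `hm` / `hn` of `ncard_image_valuePair_sol_le_const` DISCHARGED by
CosetEntryBounds (`cartan_doubleCoset_bounds`, `ord_cartan_u`, `ord_cartan_δ`). What stays displayed: the cover itself
with its Cartan representatives (the Cartan decomposition of the DVR, in words) and `K` integral. -/
theorem ncard_image_valuePair_sol_le_cartanCover (v : Valuation F (WithZero (Multiplicative ℤ))) (ϖ : F)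
    (hϖ : v ϖ = ((Multiplicative.ofAdd (-1 : ℤ) : Multiplicative ℤ) : WithZero (Multiplicative ℤ)))
    (a b c d : F) (ha : a ≠ 0) (hb : b ≠ 0) (hc : c ≠ 0) (hd : d ≠ 0) (hdet : a * d - b * c ≠ 0)
    {K : Subgroup (GL (Fin 2) F)} (hK : IsIntegralSubgroup v K)
    {ι : Type*} (T : Finset ι) (g : ι → GL (Fin 2) F) (m n : ι → ℤ)
    (hg : ∀ j, (g j : Matrix (Fin 2) (Fin 2) F) = diagonal ![ϖ ^ m j, ϖ ^ n j])
    (U : Set (Matrix (Fin 2) (Fin 2) F))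
    (hcov : U ⊆ ⋃ j ∈ T, (fun x : GL (Fin 2) F => (x : Matrix (Fin 2) (Fin 2) F)) ''
      DoubleCoset.doubleCoset (g j) (K : Set (GL (Fin 2) F)) K)
    (M₁ M₂ : ℤ) (hM₁ : 0 ≤ M₁) (hM₂ : 0 ≤ M₂)
    (he₁ : ord ((Valuation.ne_zero_iff v).2 hdet) - ord ((Valuation.ne_zero_iff v).2 ha) -
            ord ((Valuation.ne_zero_iff v).2 hd) ≤ M₁)
    (he₂ : ord ((Valuation.ne_zero_iff v).2 hdet) - ord ((Valuation.ne_zero_iff v).2 hb) -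
            ord ((Valuation.ne_zero_iff v).2 hc) ≤ M₂) :
    ((valuePair v '' sol a b c d U).ncard : ℤ) ≤
      (∑ j ∈ T, (1 + |m j - n j|) ^ 2) * ((1 + M₁) * (1 + M₂)) :=
  ncard_image_valuePair_sol_le_const v a b c d ha hb hc hd hdet T _
    (fun j => max (v (ϖ ^ m j)) (v (ϖ ^ n j))) (fun j => v (ϖ ^ m j) * v (ϖ ^ n j))
    (fun j => cartan_u_ne_zero v ϖ hϖ (m j) (n j)) (fun j => cartan_δ_ne_zero v ϖ hϖ (m j) (n j))
    m n (fun j => ord_cartan_u v ϖ hϖ (m j) (n j) _) (fun j => ord_cartan_δ v ϖ hϖ (m j) (n j) _)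
    (fun j _ => cartan_doubleCoset_bounds v ϖ hK (g j) (m j) (n j) (hg j)) U hcov M₁ M₂ hM₁ hM₂ he₁ he₂

end CartanCover

/-! ## E2. The model `K = GL₂(O)`: DoubleCosetCover's `integralSubgroup (v.integer)` is integral -/

section Model

open WithZero Multiplicative Summit.Ventures.HodgeRepro2.Tier7.Line3.CosetEntryBounds
  Summit.Ventures.HodgeRepro2.Tier7.Line3.DoubleCosetCover

variable {F : Type*} [Field F] {Γ₀ : Type*} [LinearOrderedCommGroupWithZero Γ₀]

/-- **the model `K = GL₂(O)` is integral**: DoubleCosetCover's `integralSubgroup O` for `O = v.integer = {x | v x ≤ 1}`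
satisfies CosetEntryBounds' `IsIntegralSubgroup v` (its first membership clause IS the predicate; the inverse clause is
the consequence `det_eq_one_of_mem` re-derives). -/
theorem isIntegralSubgroup_integralSubgroup (v : Valuation F Γ₀) :
    IsIntegralSubgroup v (integralSubgroup v.integer) := fun k hk i l =>
  (Valuation.mem_integer_iff v _).1 (((mem_integralSubgroup v.integer k).1 hk).1 i l)

/-- **THE COUNT-SIDE LINK AT A CARTAN COVER OF THE MODEL `K = GL₂(O)`**: `ncard_image_valuePair_sol_le_cartanCover` with
`K := integralSubgroup (v.integer)` — `hK` discharged; what stays displayed is the cover by the Cartan double cosets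
`K diag(ϖ^{m_j}, ϖ^{n_j}) K`, `j ∈ T` (the Cartan decomposition of the DVR, in words). -/
theorem ncard_image_valuePair_sol_le_cartanCover_model (v : Valuation F (WithZero (Multiplicative ℤ))) (ϖ : F)
    (hϖ : v ϖ = ((Multiplicative.ofAdd (-1 : ℤ) : Multiplicative ℤ) : WithZero (Multiplicative ℤ)))
    (a b c d : F) (ha : a ≠ 0) (hb : b ≠ 0) (hc : c ≠ 0) (hd : d ≠ 0) (hdet : a * d - b * c ≠ 0)
    {ι : Type*} (T : Finset ι) (g : ι → GL (Fin 2) F) (m n : ι → ℤ)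
    (hg : ∀ j, (g j : Matrix (Fin 2) (Fin 2) F) = diagonal ![ϖ ^ m j, ϖ ^ n j])
    (U : Set (Matrix (Fin 2) (Fin 2) F))
    (hcov : U ⊆ ⋃ j ∈ T, (fun x : GL (Fin 2) F => (x : Matrix (Fin 2) (Fin 2) F)) ''
      DoubleCoset.doubleCoset (g j) (integralSubgroup v.integer : Set (GL (Fin 2) F)) (integralSubgroup v.integer))
    (M₁ M₂ : ℤ) (hM₁ : 0 ≤ M₁) (hM₂ : 0 ≤ M₂)
    (he₁ : ord ((Valuation.ne_zero_iff v).2 hdet) - ord ((Valuation.ne_zero_iff v).2 ha) -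
            ord ((Valuation.ne_zero_iff v).2 hd) ≤ M₁)
    (he₂ : ord ((Valuation.ne_zero_iff v).2 hdet) - ord ((Valuation.ne_zero_iff v).2 hb) -
            ord ((Valuation.ne_zero_iff v).2 hc) ≤ M₂) :
    ((valuePair v '' sol a b c d U).ncard : ℤ) ≤
      (∑ j ∈ T, (1 + |m j - n j|) ^ 2) * ((1 + M₁) * (1 + M₂)) :=
  ncard_image_valuePair_sol_le_cartanCover v ϖ hϖ a b c d ha hb hc hd hdet
    (isIntegralSubgroup_integralSubgroup v) T g m n hg U hcov M₁ M₂ hM₁ hM₂ he₁ he₂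

end Model

/-! ## E3. The consumer: the split product with constants as a theorem of per-place covers (CoverCountLink's C4, moved here by the 400-line rule) -/

section Consumer

open WithZero Multiplicative IsDedekindDomain IsDedekindDomain.HeightOneSpectrum NumberField Function
  Summit.Ventures.HodgeRepro2.Tier7.Line3.SplitFactorProduct
  Summit.Ventures.HodgeRepro2.Tier7.Line3.SplitFactorConstants
open scoped NumberField

variable {K : Type*} [Field K] [NumberField K] {Orb : Type*}

/-- **THE SPLIT PRODUCT WITH CONSTANTS FROM PER-PLACE COVERS**: SplitFactorConstants' `exists_splitFactor_le_const`
with `b w γ := #(value pairs of the solutions of `U w` at `γ`)` and `Cw w := max 1 (∑_{j ∈ T w} (1 + |m_j − n_j|)²)`,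
its per-place bound `hb` DISCHARGED by `ncard_image_valuePair_sol_le_real` at every place: given, at each place
`w`, the displayed cover `U w ⊆ ⋃_{j ∈ T w} D w j` with its Cartan data and, for each `γ`, the entries of `γ` read
in `F w` with `e₁ ≤ ord_w (I γ)`, `e₂ ≤ ord_w (J γ)` (the dictionary: `e₁ = ord_w κ(γ)`, `I γ` the numerator ideal of
`κ(γ)`, in words — `multiplicity` is Mathlib's `multiplicity w.asIdeal (I γ)`, the exponent of `w` in `I γ`, exactly
SplitFactorConstants' binder), and the two displayed finite-support clauses, there is ONE constant `C` with
`splitFactor b γ ≤ C · (N(I γ) · N(J γ))^ε` for all `γ`. The hypotheses `ha hb hc hd hdet` ask every `γ` to have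
non-zero entries and determinant at every place, so the count `b w γ` is the true cardinality everywhere (no junk
value is used); degenerate `γ` are outside the statement. -/
theorem exists_splitFactor_le_of_covers (I J : Orb → Ideal (𝓞 K)) {ε : ℝ} (hε : 0 < ε)
    (hI : ∀ γ, I γ ≠ ⊥) (hJ : ∀ γ, J γ ≠ ⊥)
    (F : HeightOneSpectrum (𝓞 K) → Type*) [∀ w, Field (F w)]
    (v : ∀ w, Valuation (F w) (WithZero (Multiplicative ℤ)))
    (a b c d : ∀ w, Orb → F w)
    (ha : ∀ w γ, a w γ ≠ 0) (hb : ∀ w γ, b w γ ≠ 0) (hc : ∀ w γ, c w γ ≠ 0) (hd : ∀ w γ, d w γ ≠ 0)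
    (hdet : ∀ w γ, a w γ * d w γ - b w γ * c w γ ≠ 0)
    (ι : HeightOneSpectrum (𝓞 K) → Type*) (T : ∀ w, Finset (ι w))
    (D : ∀ w, ι w → Set (Matrix (Fin 2) (Fin 2) (F w)))
    (u δ : ∀ w, ι w → WithZero (Multiplicative ℤ)) (hu : ∀ w j, u w j ≠ 0) (hδ : ∀ w j, δ w j ≠ 0)
    (m n : ∀ w, ι w → ℤ) (hm : ∀ w j, ord (hu w j) = -min (m w j) (n w j))
    (hn : ∀ w j, ord (hδ w j) = -(m w j + n w j))
    (hD : ∀ w, ∀ j ∈ T w, ∀ M ∈ D w j, (∀ i k, v w (M i k) ≤ u w j) ∧ v w M.det = δ w j)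
    (U : ∀ w, Set (Matrix (Fin 2) (Fin 2) (F w))) (hcov : ∀ w, U w ⊆ ⋃ j ∈ T w, D w j)
    (he₁ : ∀ w γ, ord ((Valuation.ne_zero_iff (v w)).2 (hdet w γ)) - ord ((Valuation.ne_zero_iff (v w)).2 (ha w γ)) -
            ord ((Valuation.ne_zero_iff (v w)).2 (hd w γ)) ≤ (multiplicity w.asIdeal (I γ) : ℤ))
    (he₂ : ∀ w γ, ord ((Valuation.ne_zero_iff (v w)).2 (hdet w γ)) - ord ((Valuation.ne_zero_iff (v w)).2 (hb w γ)) -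
            ord ((Valuation.ne_zero_iff (v w)).2 (hc w γ)) ≤ (multiplicity w.asIdeal (J γ) : ℤ))
    (hCwfin : (mulSupport fun w => max (1 : ℝ) ((∑ j ∈ T w, (1 + |m w j - n w j|) ^ 2 : ℤ) : ℝ)).Finite)
    (hfin : ∀ γ, (mulSupport fun w =>
      ((valuePair (v w) '' sol (a w γ) (b w γ) (c w γ) (d w γ) (U w)).ncard : ℝ)).Finite) :
    ∃ C : ℝ, 0 < C ∧ ∀ γ,
      splitFactor (fun w γ => (valuePair (v w) '' sol (a w γ) (b w γ) (c w γ) (d w γ) (U w)).ncard) γ ≤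
        C * ((Ideal.absNorm (I γ) : ℝ) * Ideal.absNorm (J γ)) ^ ε :=
  exists_splitFactor_le_const (fun w γ => (valuePair (v w) '' sol (a w γ) (b w γ) (c w γ) (d w γ) (U w)).ncard)
    I J hε hI hJ hfin (fun w => max (1 : ℝ) ((∑ j ∈ T w, (1 + |m w j - n w j|) ^ 2 : ℤ) : ℝ))
    (fun _ => le_max_left _ _) hCwfin fun w γ =>
      ncard_image_valuePair_sol_le_real (v w) (a w γ) (b w γ) (c w γ) (d w γ) (ha w γ) (hb w γ) (hc w γ) (hd w γ)
        (hdet w γ) (T w) (D w) (u w) (δ w) (hu w) (hδ w) (m w) (n w) (hm w) (hn w) (hD w) (U w) (hcov w)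
        (multiplicity w.asIdeal (I γ)) (multiplicity w.asIdeal (J γ)) (he₁ w γ) (he₂ w γ)

end Consumer

end Summit.Ventures.HodgeRepro2.Tier7.Line3.CoverCountCartan
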